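import Summits.BirchSwinnertonDyer.BirchSwinnertonDyer.Theses.SignedLowerHalves
import Summits.BirchSwinnertonDyer.BirchSwinnertonDyer.Theorems.SignedLowerHalvesSprungLowerHalfAtThreeSprungPair
import Summits.BirchSwinnertonDyer.BirchSwinnertonDyer.Theorems.SignedLowerHalvesSprungLowerHalfAtThreeFWLocus
import Summits.BirchSwinnertonDyer.BirchSwinnertonDyer.Theorems.SignedLowerHalvesSprungLowerHalfAtThreeSprungPairOfModularity
import HarnessLib

/-!
# Route `SignedLowerHalves`, crux `SprungLowerHalfAtThree` (item stmt-BirchSwinnertonDyer-19003), stub (B)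
# `stub_chromaticDivisibility`: (1) the rank-positive half CLOSED (ξ = h = 0), (2) the glued split
# «(B) ⇐ (K•) ∧ (MC↓•)» over an ABSTRACT chromatic Selmer-dual theory — the interface a typing of Sprung's
# `X^♯/♭(E/ℚ_∞)` must deliver (cell `bsd-ssimc`, seat `bsd-ssimc-k3c5-kdot-split` g0, ACCEL-LIST row (2);
# a `--supports … --as helper` file, closes nothing)

PARTITION (cell bsd-ssimc): X8 (A8) — `p = 3` good supersingular, `a_3 = ±3` — crux 5's clause (B) at every
analytic rank; types-the-object-of; closes NONE; nothing is booked; BSD is not proved by any of this.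

## What this file proves

§1 **The rank-positive half of (B), CLOSED.** The registered stub (B) asks, for an X8 pair and the real
objects `(f, ϖ, L♯, L♭)` of stub (A), a colour `•` and `ξ ∈ Λ` with Kim's bare-datum Euler characteristic
(`(⟨ξ,0,0⟩ : SignedDatum W p).EulerCharacteristic`: IF `Sel_{p^∞}(E/ℚ)` is finite THEN
`ξ(0) = u·p^{ord ∏c}·#Sel`) and `ι ξ = ϖ·ι(L^•·h)`. When `Sel_{p^∞}(E/ℚ)` is INFINITE the premise of (K)
fails and `ξ = h = 0` is a witness (`chromaticDatum_of_not_finite_selmer`, p417882). Here: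
* `not_finite_selmerGroupPInfty_of_mordellWeilRank_ne_zero` — `rank E(ℚ) ≠ 0 ⇒ Sel_{p^∞}(E/ℚ)` infinite
  (corank identity `corank Sel_{p^∞} = rank + corank Ш[p^∞]`, Greenberg LNM 1716 §1, a tree theorem);
* `chromaticDivisibility_of_mordellWeilRank_ne_zero` — hence (B)'s conclusion for EVERY `W`, `p`, `ϖ`
  and pair, FLAG-FREE, whenever `rank E(ℚ) ≥ 1`;
* `chromaticDivisibility_of_analyticRank_eq_one` / `stub_chromaticDivisibility_of_analyticRank_eq_one` —
  at analytic rank `1`, Gross–Zagier–Kolyvagin (`hGZK`, PUBLISHED, by name) gives `rank E(ℚ) = 1`, so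
  (B) holds; the second is the registered stub header VERBATIM with `W.analyticRank = 1` inserted. So on
  X8 ∩ {r_an = 1} (board A8's rank-1 cells) clause (B) is closed modulo GZK alone — as the planner's
  TENURE NOTE v2 predicted («stub (B) is witnessed by ξ = 0, h = 0 once the objects of (A) exist»).

§2 **The glued split, kernel form.** The INTENDED content of (B) (TENURE NOTE v2 of `Lines/birth.md`) is
the ♯/♭ Eisenstein divisibility `ϖ·L^• ∣ char X^•(E/ℚ_∞)` (Sprung 2012 Main Conj. 7.21 / Sprung 2024
Thm 1.1's lower inclusion) glued to the ♯/♭ Euler-characteristic formula (K•) (Sprung 2024 Lemmas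
5.5–5.9, UNCONDITIONAL in print) — both statements about the Pontryagin dual `X^•` of Sprung's chromatic
Selmer group `Sel^•(E/ℚ_∞)` (Sprung 2012 Def. 7.11), whose local condition at `p` is the exact annihilator
of `ker Col^•` (Def. 7.9) and has NO elementary (trace-map) description in print (Sprung 2012, Open
Problem 7.22, p. 1505); the ledger's definition item `defn-SharpFlatSelmerDualData` and cite item
`wi-68275` are BLOCKED on exactly that (an `H¹_Iw` + Coleman-map typing programme). This file therefore
proves the glue ONCE AND FOR ALL over an ABSTRACT chromatic Selmer-dual theory, displayed as
higher-order binders — a family of TYPES `Dual W p κ γ c` (intended: `X^c(E/ℚ_∞)` with its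
`Λ = ℤ_p⟦T⟧`-structure, `T = γ − 1`), a characteristic ideal `charIdeal D`, and NON-EMPTINESS in the
cyclotomic setting (intended: the Pontryagin dual exists, as `Kobayashi2003.nonempty_signedSelmerDualData`
does for `Sel^±`) — with the two inputs as predicates over it, exactly parallel to the tree's genuine ±
road `missingLowerBoundAt_of_kobayashiLowerDivisibility` (`KobayashiMainConjecture.lean`):
* (K•)(Dual): for every `D : Dual W p κ γ c` and generator `g` of `charIdeal D`, the bare datum `⟨g,0,0⟩`
  has Kim's property `SignedDatum.EulerCharacteristic` (the bookkeeping target the planner fixed for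
  `wi-68275`);
* (MC↓•)(Dual): for the real objects of (A) and SOME colour `•`, every `D : Dual W p κ γ •` has
  `charIdeal D = (g)` with `ι g = ϖ·ι(L^•·h)` (shape of `KobayashiLowerDivisibility W p ε`);
* `stub_chromaticDivisibility_of_split` — (K•)(Dual) ∧ (MC↓•)(Dual) ⇒ the registered stub (B) VERBATIM,
  rank-free and case-free (`ξ := g`): the cyclotomic setting exists
  (`exists_isCyclotomic_isTopGenerator_isCyclotomicVariable_holds`), `Dual` is inhabited there, and the two
  predicates are read off. `SprungLowerHalfAtThree_of_split` — with stub (A)'s inputs (modularity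
  `exists_isNewformOf`, the period unit at `3`, Sprung's theorem `thm112_exists_isSprungPair_holds`, via the
  landed `stub_sprungPair_of_modularity_of_periodUnit`, p417663) the crux BY NAME.
HONEST STATUS: §2 is a SHAPE theorem — it quantifies over the theory; that Sprung's `X^♯/♭` IS such a
theory with (K•) PROVED (Sprung 2024 §5.2) and (MC↓•) OPEN at `(3, ±3)` (Sprung 2024 Thm 1.1 ⇐ Conj. 3.33;
CCSS arXiv:1804.10993 / Fouquet–Wan arXiv:2107.13726 PRE) is the content of the citations and is NOT
asserted; instantiating `Dual` is the typing programme's job, after which the r0 residue of X8 reads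
(MC↓•) by name. Nothing here narrows any class.

References: [Sprung2012] Def. 7.9/7.11, Main Conj. 7.21, Prop. 7.19, Open Problem 7.22 (p. 1505);
[Sprung2024] §5.2 Lemmas 5.5–5.9, Thm 1.1; [Sprung2017] Thm. 1.12; [Kobayashi2003] Def. 1.1;
[GreenbergLNM1716] §1; [Darmon2004] Thm. 3.22 (GZK); [Miller2011LMS] Def. 1.1.
-/

set_option autoImplicit false
set_option linter.dupNamespace false

noncomputable section

open scoped Classical MatrixGroups ModularForm

open CongruenceSubgroup WeierstrassCurve Literature.NumberTheory.EllipticCurves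
  Literature.NumberTheory.EllipticCurves.ModularForms
  Literature.NumberTheory.EllipticCurves.Rank1Residual
  Literature.NumberTheory.EllipticCurves.Rank1Residual.Typed
  Literature.NumberTheory.EllipticCurves.Sprung2017
  Summit.BirchSwinnertonDyer.Rank1Residual.Supersingular ZpExtension

namespace Summit.BirchSwinnertonDyer.BirchSwinnertonDyer.Theorems

/-! ### §1 The rank-positive half of stub (B) -/

section RankPositive

variable (W : WeierstrassCurve ℚ) [W.IsElliptic] (p : ℕ) [Fact p.Prime]

/-- **Positive Mordell–Weil rank forces an infinite `p^∞`-Selmer group**: `rank E(ℚ) ≠ 0 ⇒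
Sel_{p^∞}(E/ℚ)` is not finite — contrapositive of the corank-zero lemma
`mordellWeilRank_eq_zero_of_finite_selmerGroupPInfty` (corank identity
`corank Sel_{p^∞} = rank E(ℚ) + corank Ш[p^∞]`, Greenberg LNM 1716 §1, tree theorem
`selmerCorank_eq_mordellWeilRank_add_holds`). [cite: GreenbergLNM1716, §1 p. 54] -/
theorem not_finite_selmerGroupPInfty_of_mordellWeilRank_ne_zero (hr : W.mordellWeilRank ≠ 0) :
    ¬ Finite (W.selmerGroupPInfty p) :=
  fun hfin ↦ hr (mordellWeilRank_eq_zero_of_finite_selmerGroupPInfty W p hfin)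

/-- **(B) in positive rank, FLAG-FREE.** For ANY elliptic `W/ℚ` with `rank E(ℚ) ≠ 0`, any prime `p`,
any `ϖ ∈ ℚ` and any pair `(L♯, L♭) ∈ Λ²`: for either colour `•` there is `ξ ∈ Λ` (namely `ξ = 0`) whose
bare signed datum has Kim's Euler-characteristic property (vacuously: `Sel_{p^∞}(E/ℚ)` is infinite) and
with `ι ξ = ϖ·ι(L^•·h)` (`h = 0`). No hypothesis on `p`, no X8, no named fact. [cite: GreenbergLNM1716, §1 p. 54] -/
theorem chromaticDivisibility_of_mordellWeilRank_ne_zero (hr : W.mordellWeilRank ≠ 0) (ϖ : ℚ)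
    (Lsharp Lflat : IwasawaAlgebra p) (c : Chroma) :
    ∃ ξ : IwasawaAlgebra p, (⟨ξ, 0, 0⟩ : SignedDatum W p).EulerCharacteristic ∧
      ∃ h : IwasawaAlgebra p, iwasawaToPowerSeries p ξ =
        PowerSeries.C (ϖ : ℚ_[p]) * iwasawaToPowerSeries p (chromaticL c Lsharp Lflat * h) :=
  chromaticDatum_of_not_finite_selmer W p
    (not_finite_selmerGroupPInfty_of_mordellWeilRank_ne_zero W p hr) ϖ (chromaticL c Lsharp Lflat)

/-- **(B) at analytic rank `1`, modulo GZK by name.** For ANY elliptic `W/ℚ` with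
`ord_{s=1} L(E,s) = 1`, Gross–Zagier–Kolyvagin (`hGZK`: `r_an ≤ 1 ⇒ rank E(ℚ) = r_an`, PUBLISHED —
Darmon 2004 Thm. 3.22) gives `rank E(ℚ) = 1 ≠ 0`, so (B)'s conclusion holds for every `p`, `ϖ`, pair
and colour by `chromaticDivisibility_of_mordellWeilRank_ne_zero`. CONDITIONAL on `hGZK` only.
[cite: Darmon2004, Thm. 3.22 (= Thm. 1.14)] [cite: GreenbergLNM1716, §1 p. 54] -/
theorem chromaticDivisibility_of_analyticRank_eq_one
    (hGZK : rank_eq_analyticRank_of_analyticRank_le_one) (hr : W.analyticRank = 1) (ϖ : ℚ)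
    (Lsharp Lflat : IwasawaAlgebra p) (c : Chroma) :
    ∃ ξ : IwasawaAlgebra p, (⟨ξ, 0, 0⟩ : SignedDatum W p).EulerCharacteristic ∧
      ∃ h : IwasawaAlgebra p, iwasawaToPowerSeries p ξ =
        PowerSeries.C (ϖ : ℚ_[p]) * iwasawaToPowerSeries p (chromaticL c Lsharp Lflat * h) := by
  have hrk : W.mordellWeilRank = 1 := (hGZK W (by omega)).1.trans hr
  exact chromaticDivisibility_of_mordellWeilRank_ne_zero W p (by omega) ϖ Lsharp Lflat c

/-- **The registered stub (B) VERBATIM on X8 ∩ {r_an = 1}, modulo GZK.** The header of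
`stub_chromaticDivisibility` (skeleton `Cruxes/SprungLowerHalfAtThree/Lines/birth.lean`) with the single
extra hypothesis `W.analyticRank = 1`, from the published fact `hGZK` alone (colour `♭`; `ξ = h = 0`).
What it buys on X8 (board A8): every rank-1 cell reads «(B) closed modulo GZK (published)»; crux 5's
clause (B) is a rank-0 matter only. CONDITIONAL on `hGZK`; closes nothing.
[cite: Darmon2004, Thm. 3.22 (= Thm. 1.14)] [cite: GreenbergLNM1716, §1 p. 54] -/
theorem stub_chromaticDivisibility_of_analyticRank_eq_one
    (hGZK : rank_eq_analyticRank_of_analyticRank_le_one) :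
    ∀ (W : WeierstrassCurve ℚ) [W.IsElliptic] [W.IsGloballyMinimal] (p : ℕ) [Fact p.Prime],
      Literature.NumberTheory.EllipticCurves.Rank1Residual.ClassX8 W p → W.analyticRank = 1 →
      ∀ (N : ℕ) (_ : NeZero N) (f : CuspForm (CongruenceSubgroup.Gamma0 N) 2) (ϖ : ℚ)
        (Lsharp Lflat : Literature.NumberTheory.EllipticCurves.IwasawaAlgebra p),
        Literature.NumberTheory.EllipticCurves.ModularForms.IsNewformOf W f →
        (ϖ : ℝ) * W.realPeriodRat = Literature.NumberTheory.EllipticCurves.ModularForms.plusPeriod f →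
        Literature.NumberTheory.EllipticCurves.Sprung2017.IsSprungPair f p (W.frobeniusTrace p)
          Lsharp Lflat →
        ∃ (c : Literature.NumberTheory.EllipticCurves.Sprung2017.Chroma)
          (ξ : Literature.NumberTheory.EllipticCurves.IwasawaAlgebra p),
          (⟨ξ, 0, 0⟩ : Summit.BirchSwinnertonDyer.Rank1Residual.Supersingular.SignedDatum W p).EulerCharacteristic ∧
          ∃ h : Literature.NumberTheory.EllipticCurves.IwasawaAlgebra p,
            Literature.NumberTheory.EllipticCurves.iwasawaToPowerSeries p ξ =
              PowerSeries.C (ϖ : ℚ_[p]) *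
                Literature.NumberTheory.EllipticCurves.iwasawaToPowerSeries p
                  (Literature.NumberTheory.EllipticCurves.Sprung2017.chromaticL c Lsharp Lflat * h) := by
  intro W _ _ p _ _hX hr N _ f ϖ Lsharp Lflat _hf _hϖ _hSP
  exact ⟨.flat, chromaticDivisibility_of_analyticRank_eq_one W p hGZK hr ϖ Lsharp Lflat .flat⟩

end RankPositive

/-! ### §2 The glued split over an abstract chromatic Selmer-dual theory -/

section Split

/-- **The glued split «(B) ⇐ (K•) ∧ (MC↓•)», kernel form, over an ABSTRACT chromatic Selmer-dual
theory.** Binders: `Dual W p κ γ c` — a family of types (intended instance, NOT constructible in the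
tree today: the Pontryagin dual `X^c(E/ℚ_∞)` of Sprung's chromatic Selmer group, Sprung 2012 Def. 7.11,
with its `Λ`-structure `T = γ − 1`); `charIdeal` — its characteristic ideal; `hne` — the dual exists in
the cyclotomic setting (as `Kobayashi2003.nonempty_signedSelmerDualData` for `Sel^±`); `hK` — (K•) as the
bookkeeping statement into `SignedDatum.EulerCharacteristic` for every generator of `charIdeal D`
(Sprung 2024 Lemmas 5.5–5.9 for the intended instance: PROVED in print, unconditional); `hdiv` —
(MC↓•): on X8, for the real objects of stub (A) and SOME colour, `charIdeal D = (g)` with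
`ι g = ϖ·ι(L^•·h)` for every `D` (Sprung 2012 Main Conj. 7.21's Eisenstein half; OPEN at `(3, ±3)`).
Conclusion: the registered stub `stub_chromaticDivisibility` VERBATIM — rank-free, no case split
(`ξ := g`; the cyclotomic pair `(κ, γ)` from `exists_isCyclotomic_isTopGenerator_isCyclotomicVariable_holds`).
A SHAPE theorem: nothing about Sprung's objects is asserted; it records exactly what a typing of
`X^♯/♭` must supply for crux 5. [cite: Sprung2012, Def. 7.11 and Main Conj. 7.21 (shape only)]
[cite: Kobayashi2003, Def. 1.1 (shape only)] -/
theorem stub_chromaticDivisibility_of_split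
    (Dual : ∀ (W : WeierstrassCurve ℚ) (p : ℕ) [Fact p.Prime],
      ZpExtension ℚ p → Field.absoluteGaloisGroup ℚ → Chroma → Type)
    (charIdeal : ∀ {W : WeierstrassCurve ℚ} {p : ℕ} [Fact p.Prime] {κ : ZpExtension ℚ p}
      {γ : Field.absoluteGaloisGroup ℚ} {c : Chroma}, Dual W p κ γ c → Ideal (IwasawaAlgebra p))
    (hne : ∀ (W : WeierstrassCurve ℚ) (p : ℕ) [Fact p.Prime] (κ : ZpExtension ℚ p)
      (γ : Field.absoluteGaloisGroup ℚ) (c : Chroma),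
      κ.IsCyclotomic → κ.IsTopGenerator γ → Nonempty (Dual W p κ γ c))
    (hK : ∀ (W : WeierstrassCurve ℚ) [W.IsElliptic] [W.IsGloballyMinimal] (p : ℕ) [Fact p.Prime]
      (κ : ZpExtension ℚ p) (γ : Field.absoluteGaloisGroup ℚ) (c : Chroma),
      ClassX8 W p → κ.IsCyclotomic → κ.IsTopGenerator γ →
      ∀ (D : Dual W p κ γ c) (g : IwasawaAlgebra p), charIdeal D = Ideal.span {g} →
        (⟨g, 0, 0⟩ : SignedDatum W p).EulerCharacteristic)
    (hdiv : ∀ (W : WeierstrassCurve ℚ) [W.IsElliptic] [W.IsGloballyMinimal] (p : ℕ) [Fact p.Prime],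
      ClassX8 W p → ∀ (κ : ZpExtension ℚ p) (γ : Field.absoluteGaloisGroup ℚ),
        κ.IsCyclotomic → κ.IsTopGenerator γ → IsCyclotomicVariable p γ →
      ∀ (N : ℕ) (_ : NeZero N) (f : CuspForm (Gamma0 N) 2) (ϖ : ℚ) (Lsharp Lflat : IwasawaAlgebra p),
        IsNewformOf W f → (ϖ : ℝ) * W.realPeriodRat = plusPeriod f →
        IsSprungPair f p (W.frobeniusTrace p) Lsharp Lflat →
        ∃ c : Chroma, ∀ D : Dual W p κ γ c, ∃ g h : IwasawaAlgebra p,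
          charIdeal D = Ideal.span {g} ∧
            iwasawaToPowerSeries p g =
              PowerSeries.C (ϖ : ℚ_[p]) * iwasawaToPowerSeries p (chromaticL c Lsharp Lflat * h)) :
    ∀ (W : WeierstrassCurve ℚ) [W.IsElliptic] [W.IsGloballyMinimal] (p : ℕ) [Fact p.Prime],
      Literature.NumberTheory.EllipticCurves.Rank1Residual.ClassX8 W p →
      ∀ (N : ℕ) (_ : NeZero N) (f : CuspForm (CongruenceSubgroup.Gamma0 N) 2) (ϖ : ℚ)
        (Lsharp Lflat : Literature.NumberTheory.EllipticCurves.IwasawaAlgebra p),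
        Literature.NumberTheory.EllipticCurves.ModularForms.IsNewformOf W f →
        (ϖ : ℝ) * W.realPeriodRat = Literature.NumberTheory.EllipticCurves.ModularForms.plusPeriod f →
        Literature.NumberTheory.EllipticCurves.Sprung2017.IsSprungPair f p (W.frobeniusTrace p)
          Lsharp Lflat →
        ∃ (c : Literature.NumberTheory.EllipticCurves.Sprung2017.Chroma)
          (ξ : Literature.NumberTheory.EllipticCurves.IwasawaAlgebra p),
          (⟨ξ, 0, 0⟩ : Summit.BirchSwinnertonDyer.Rank1Residual.Supersingular.SignedDatum W p).EulerCharacteristic ∧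
          ∃ h : Literature.NumberTheory.EllipticCurves.IwasawaAlgebra p,
            Literature.NumberTheory.EllipticCurves.iwasawaToPowerSeries p ξ =
              PowerSeries.C (ϖ : ℚ_[p]) *
                Literature.NumberTheory.EllipticCurves.iwasawaToPowerSeries p
                  (Literature.NumberTheory.EllipticCurves.Sprung2017.chromaticL c Lsharp Lflat * h) := by
  intro W _ _ p _ hX N hN f ϖ Lsharp Lflat hf hϖ hSP
  -- the cyclotomic setting `(κ, γ)`
  obtain ⟨κ, hκ, γ, hγ, hγ'⟩ := exists_isCyclotomic_isTopGenerator_isCyclotomicVariable_holds p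
  -- (MC↓•): a colour and, for every dual datum, `char = (g)`, `ι g = ϖ · ι(L^• h)`
  obtain ⟨c, hc⟩ := hdiv W p hX κ γ hκ hγ hγ' N hN f ϖ Lsharp Lflat hf hϖ hSP
  -- the dual datum exists
  obtain ⟨D⟩ := hne W p κ γ c hκ hγ
  obtain ⟨g, h, hchar, hιg⟩ := hc D
  -- (K•): the generator `g` has Kim's Euler-characteristic property
  exact ⟨c, g, hK W p κ γ c hX hκ hγ D g hchar, h, hιg⟩

/-- **The crux BY NAME from the split.** Stub (A)'s inputs — modularity (`hmodE : exists_isNewformOf`),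
the period-ratio unit at `3` (`hper`), both PUBLISHED, with Sprung's pair-existence theorem proved in
the tree — via the landed helper `stub_sprungPair_of_modularity_of_periodUnit` (p417663), plus the split
inputs (K•)(Dual), (MC↓•)(Dual) of `stub_chromaticDivisibility_of_split`, give
`SprungLowerHalfAtThree` exactly as the registered composition `SprungLowerHalfAtThree_of` does.
CONDITIONAL (named-fact hypotheses `hmodE`, `hper`; shape binders `Dual…hdiv`); closes nothing by itself.
[cite: Sprung2012, Main Conj. 7.21 (shape only)] [cite: DiamondShurman2005, Thm. 8.8.3]
[cite: GreenbergVatsal2000, §3 Remark 3.4] -/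
theorem SprungLowerHalfAtThree_of_split
    (hmodE : exists_isNewformOf) (hper : realPeriodRat_eq_unit_mul_plusPeriod_three)
    (Dual : ∀ (W : WeierstrassCurve ℚ) (p : ℕ) [Fact p.Prime],
      ZpExtension ℚ p → Field.absoluteGaloisGroup ℚ → Chroma → Type)
    (charIdeal : ∀ {W : WeierstrassCurve ℚ} {p : ℕ} [Fact p.Prime] {κ : ZpExtension ℚ p}
      {γ : Field.absoluteGaloisGroup ℚ} {c : Chroma}, Dual W p κ γ c → Ideal (IwasawaAlgebra p))
    (hne : ∀ (W : WeierstrassCurve ℚ) (p : ℕ) [Fact p.Prime] (κ : ZpExtension ℚ p)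
      (γ : Field.absoluteGaloisGroup ℚ) (c : Chroma),
      κ.IsCyclotomic → κ.IsTopGenerator γ → Nonempty (Dual W p κ γ c))
    (hK : ∀ (W : WeierstrassCurve ℚ) [W.IsElliptic] [W.IsGloballyMinimal] (p : ℕ) [Fact p.Prime]
      (κ : ZpExtension ℚ p) (γ : Field.absoluteGaloisGroup ℚ) (c : Chroma),
      ClassX8 W p → κ.IsCyclotomic → κ.IsTopGenerator γ →
      ∀ (D : Dual W p κ γ c) (g : IwasawaAlgebra p), charIdeal D = Ideal.span {g} →
        (⟨g, 0, 0⟩ : SignedDatum W p).EulerCharacteristic)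
    (hdiv : ∀ (W : WeierstrassCurve ℚ) [W.IsElliptic] [W.IsGloballyMinimal] (p : ℕ) [Fact p.Prime],
      ClassX8 W p → ∀ (κ : ZpExtension ℚ p) (γ : Field.absoluteGaloisGroup ℚ),
        κ.IsCyclotomic → κ.IsTopGenerator γ → IsCyclotomicVariable p γ →
      ∀ (N : ℕ) (_ : NeZero N) (f : CuspForm (Gamma0 N) 2) (ϖ : ℚ) (Lsharp Lflat : IwasawaAlgebra p),
        IsNewformOf W f → (ϖ : ℝ) * W.realPeriodRat = plusPeriod f →
        IsSprungPair f p (W.frobeniusTrace p) Lsharp Lflat →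
        ∃ c : Chroma, ∀ D : Dual W p κ γ c, ∃ g h : IwasawaAlgebra p,
          charIdeal D = Ideal.span {g} ∧
            iwasawaToPowerSeries p g =
              PowerSeries.C (ϖ : ℚ_[p]) * iwasawaToPowerSeries p (chromaticL c Lsharp Lflat * h)) :
    Summit.BirchSwinnertonDyer.BirchSwinnertonDyer.Theses.SignedLowerHalves.SprungLowerHalfAtThree := by
  intro W _ _ p _ hX
  obtain ⟨N, hN, f, ϖ, Lsharp, Lflat, hf, hϖ, hSP⟩ :=
    stub_sprungPair_of_modularity_of_periodUnit hmodE hper W p hX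
  obtain ⟨c, ξ, hKξ, hd⟩ := stub_chromaticDivisibility_of_split Dual charIdeal hne hK hdiv W p hX N hN f ϖ
    Lsharp Lflat hf hϖ hSP
  exact ⟨N, hN, f, ϖ, Lsharp, Lflat, c, ξ, hf, hϖ, hSP, hKξ, hd⟩

end Split

/-! ### §3 (appended, seat `bsd-ssimc-k3c5-kdot-split` g0) The crux BY NAME from the route's REGISTERED
support item and the split

Stub (A) is closed modulo modularity ALONE (`stub_sprungPair_of_modularParametrizationSupply`, p453712: the
period-ratio rationality and Sprung's pair are tree theorems), and modularity is the route's own HELD support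
item `ModularParametrizationSupply` (stmt-BirchSwinnertonDyer-19266, eighth conjunct of
`PublishedSignedInputs`). Composing with §2: the crux `SprungLowerHalfAtThree` BY NAME from a REGISTERED
obligation plus exactly the split binders (K•)(Dual), (MC↓•)(Dual) over an abstract chromatic Selmer-dual
theory — no period fact, no unregistered named fact. -/

section SplitSupply

/-- **`SprungLowerHalfAtThree` ⟸ `ModularParametrizationSupply` (registered, HELD) ∧ (K•)(Dual) ∧
(MC↓•)(Dual).** The skeleton's composition with stub (A) fed by
`stub_sprungPair_of_modularParametrizationSupply` (p453712) and stub (B) by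
`stub_chromaticDivisibility_of_split`. SHAPE in the `Dual` binders (intended: Sprung's `X^♯/♭(E/ℚ_∞)`, not
constructible in the tree today); CONDITIONAL; closes nothing by itself.
[cite: Sprung2012, Def. 7.11 and Main Conj. 7.21 (shape only)] [cite: BCDTJAMS2001, Thm. A] -/
theorem sprungLowerHalfAtThree_of_modularParametrizationSupply_of_split
    (hmodP : Summit.BirchSwinnertonDyer.BirchSwinnertonDyer.Theses.SignedLowerHalves.ModularParametrizationSupply)
    (Dual : ∀ (W : WeierstrassCurve ℚ) (p : ℕ) [Fact p.Prime],
      ZpExtension ℚ p → Field.absoluteGaloisGroup ℚ → Chroma → Type)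
    (charIdeal : ∀ {W : WeierstrassCurve ℚ} {p : ℕ} [Fact p.Prime] {κ : ZpExtension ℚ p}
      {γ : Field.absoluteGaloisGroup ℚ} {c : Chroma}, Dual W p κ γ c → Ideal (IwasawaAlgebra p))
    (hne : ∀ (W : WeierstrassCurve ℚ) (p : ℕ) [Fact p.Prime] (κ : ZpExtension ℚ p)
      (γ : Field.absoluteGaloisGroup ℚ) (c : Chroma),
      κ.IsCyclotomic → κ.IsTopGenerator γ → Nonempty (Dual W p κ γ c))
    (hK : ∀ (W : WeierstrassCurve ℚ) [W.IsElliptic] [W.IsGloballyMinimal] (p : ℕ) [Fact p.Prime]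
      (κ : ZpExtension ℚ p) (γ : Field.absoluteGaloisGroup ℚ) (c : Chroma),
      ClassX8 W p → κ.IsCyclotomic → κ.IsTopGenerator γ →
      ∀ (D : Dual W p κ γ c) (g : IwasawaAlgebra p), charIdeal D = Ideal.span {g} →
        (⟨g, 0, 0⟩ : SignedDatum W p).EulerCharacteristic)
    (hdiv : ∀ (W : WeierstrassCurve ℚ) [W.IsElliptic] [W.IsGloballyMinimal] (p : ℕ) [Fact p.Prime],
      ClassX8 W p → ∀ (κ : ZpExtension ℚ p) (γ : Field.absoluteGaloisGroup ℚ),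
        κ.IsCyclotomic → κ.IsTopGenerator γ → IsCyclotomicVariable p γ →
      ∀ (N : ℕ) (_ : NeZero N) (f : CuspForm (Gamma0 N) 2) (ϖ : ℚ) (Lsharp Lflat : IwasawaAlgebra p),
        IsNewformOf W f → (ϖ : ℝ) * W.realPeriodRat = plusPeriod f →
        IsSprungPair f p (W.frobeniusTrace p) Lsharp Lflat →
        ∃ c : Chroma, ∀ D : Dual W p κ γ c, ∃ g h : IwasawaAlgebra p,
          charIdeal D = Ideal.span {g} ∧
            iwasawaToPowerSeries p g =
              PowerSeries.C (ϖ : ℚ_[p]) * iwasawaToPowerSeries p (chromaticL c Lsharp Lflat * h)) :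
    Summit.BirchSwinnertonDyer.BirchSwinnertonDyer.Theses.SignedLowerHalves.SprungLowerHalfAtThree :=
  sprungLowerHalfAtThree_of_modularParametrizationSupply_of_chromaticDivisibility hmodP
    (stub_chromaticDivisibility_of_split Dual charIdeal hne hK hdiv)

/-- **`SprungLowerHalfAtThree` ⟸ `PublishedSignedInputs` (the deciding theorem's binder; registered) ∧
(K•)(Dual) ∧ (MC↓•)(Dual)** — only its modularity conjunct is used. SHAPE in the `Dual` binders; CONDITIONAL;
closes nothing by itself. [cite: Sprung2012, Def. 7.11 and Main Conj. 7.21 (shape only)] [cite: BCDTJAMS2001, Thm. A] -/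
theorem sprungLowerHalfAtThree_of_publishedSignedInputs_of_split
    (hPub : Summit.BirchSwinnertonDyer.BirchSwinnertonDyer.Theses.SignedLowerHalves.PublishedSignedInputs)
    (Dual : ∀ (W : WeierstrassCurve ℚ) (p : ℕ) [Fact p.Prime],
      ZpExtension ℚ p → Field.absoluteGaloisGroup ℚ → Chroma → Type)
    (charIdeal : ∀ {W : WeierstrassCurve ℚ} {p : ℕ} [Fact p.Prime] {κ : ZpExtension ℚ p}
      {γ : Field.absoluteGaloisGroup ℚ} {c : Chroma}, Dual W p κ γ c → Ideal (IwasawaAlgebra p))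
    (hne : ∀ (W : WeierstrassCurve ℚ) (p : ℕ) [Fact p.Prime] (κ : ZpExtension ℚ p)
      (γ : Field.absoluteGaloisGroup ℚ) (c : Chroma),
      κ.IsCyclotomic → κ.IsTopGenerator γ → Nonempty (Dual W p κ γ c))
    (hK : ∀ (W : WeierstrassCurve ℚ) [W.IsElliptic] [W.IsGloballyMinimal] (p : ℕ) [Fact p.Prime]
      (κ : ZpExtension ℚ p) (γ : Field.absoluteGaloisGroup ℚ) (c : Chroma),
      ClassX8 W p → κ.IsCyclotomic → κ.IsTopGenerator γ →
      ∀ (D : Dual W p κ γ c) (g : IwasawaAlgebra p), charIdeal D = Ideal.span {g} →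
        (⟨g, 0, 0⟩ : SignedDatum W p).EulerCharacteristic)
    (hdiv : ∀ (W : WeierstrassCurve ℚ) [W.IsElliptic] [W.IsGloballyMinimal] (p : ℕ) [Fact p.Prime],
      ClassX8 W p → ∀ (κ : ZpExtension ℚ p) (γ : Field.absoluteGaloisGroup ℚ),
        κ.IsCyclotomic → κ.IsTopGenerator γ → IsCyclotomicVariable p γ →
      ∀ (N : ℕ) (_ : NeZero N) (f : CuspForm (Gamma0 N) 2) (ϖ : ℚ) (Lsharp Lflat : IwasawaAlgebra p),
        IsNewformOf W f → (ϖ : ℝ) * W.realPeriodRat = plusPeriod f →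
        IsSprungPair f p (W.frobeniusTrace p) Lsharp Lflat →
        ∃ c : Chroma, ∀ D : Dual W p κ γ c, ∃ g h : IwasawaAlgebra p,
          charIdeal D = Ideal.span {g} ∧
            iwasawaToPowerSeries p g =
              PowerSeries.C (ϖ : ℚ_[p]) * iwasawaToPowerSeries p (chromaticL c Lsharp Lflat * h)) :
    Summit.BirchSwinnertonDyer.BirchSwinnertonDyer.Theses.SignedLowerHalves.SprungLowerHalfAtThree :=
  sprungLowerHalfAtThree_of_publishedSignedInputs_of_chromaticDivisibility hPub
    (stub_chromaticDivisibility_of_split Dual charIdeal hne hK hdiv)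

end SplitSupply

end Summit.BirchSwinnertonDyer.BirchSwinnertonDyer.Theorems

end
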